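import Mathlib
import Summits.ValiantsHypothesis.ValiantsHypothesis.Theorems.DissociatedFixedK.Negative.LoadBearing
import Summits.ValiantsHypothesis.ValiantsHypothesis.Theorems.NewtonUnitEquationsDissociatedUniformStubExposedGenericDirection

/-!
# `NewtonUnitEquationsNewtonTauWeakRefineDissociate` — dissociation is free for hull-vertex counts of weighted level sets

Registered stub `stub_refineDissociate` of line `binomial-normal-form` (crux `NewtonTauWeak`, stmt-ValiantsHypothesis-5904, lead c6,
namespace `RungC6` of `Cruxes/NewtonTauWeak/Lines/binomial_normal_form.lean`, wave 2).

Setting.  `N` items with weights `g j ∈ ℕ` and exponents `d j ∈ ℕ²` (coinciding subset sums allowed), a target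
weight `v`; the weight-`v` level set is `X_v(d) = {Σ_{j∈J} d j : Σ_{j∈J} g j = v} ⊆ ℕ²` (embedded in `ℝ²` by
`e ↦ (i ↦ (e i : ℝ))`).

Claim.  There is a DISSOCIATED exponent list `d'` (all `2^N` subset sums distinct) whose level set `X_v(d')` has
at least as many hull vertices (extreme points of the convex hull) as `X_v(d)`.

Proof.
* Refinement `d' j = M • d j + (2^j, 0)`: `Σ_J d' = M • Σ_J d + (t_J, 0)` with the binary tag
  `t_J = Σ_{j∈J} 2^j < 2^N` determining `J` (`RefineDissociateAux.sum_two_pow_injective`, via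
  `Finset.geomSum_injective`).  For `M ≥ 2^N` the first coordinate of `Σ_J d'` modulo `M` is `t_J`, so `d'` is
  dissociated (`RefineDissociateAux.smul_add_single_injOn`).
* Monotonicity of the count (`RefineDissociateAux.exists_scale_ncard_le`): every extreme point `e` of the old
  hull is `emb p_e`, `p_e ∈ X_v(d)` the STRICT maximiser of a linear height `h_w` with `w 0 ≠ 0`
  (`NewtonUnitEquationsDissociatedUniform.stub_exposedGenericDirection`, genericity on `{0, (1,0)}`).  By
  finiteness there is a uniform scale `M` with `M · (h_w(p_e) − h_w(s)) > 2 |w 0| 2^N` for all `e` and all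
  `s ∈ X_v(d) ∖ {p_e}` (filter `atTop` on `ℕ`).  Then `h_w(Σ_J d') = M h_w(Σ_J d) + w 0 · t_J`, so every point of
  `X_v(d')` outside the cluster `{M p_e + (t_J, 0) : Σ_J d = p_e}` is strictly below every point of the cluster,
  and inside the cluster the height `w 0 · t_J` is injective (`w 0 ≠ 0`, `t` injective); its maximiser `q_e` is the
  strict maximiser of `h_w` over `X_v(d')`, hence an extreme point of the new hull
  (`DissociatedFixedK.Negative.mem_extremePoints_convexHull_of_strict_sep`).  Distinct `e` have distinct `p_e`,
  hence distinct `q_e` (dissociation), and `Set.ncard_le_ncard_of_injOn` concludes.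

Everything is folklore; no named facts, no citations, no `def`s.
-/

-- Sub = Summit single-conjunct layout: the duplicated namespace component is mandated by the tree.
set_option linter.dupNamespace false

noncomputable section

open scoped BigOperators
open Summit.ValiantsHypothesis.ValiantsHypothesis.Theorems.DissociatedFixedK.Negative
  (mem_extremePoints_convexHull_of_strict_sep)
open Summit.ValiantsHypothesis.ValiantsHypothesis.Theorems.NewtonUnitEquationsDissociatedUniform
  (stub_exposedGenericDirection)

namespace Summit.ValiantsHypothesis.ValiantsHypothesis.Theorems.NewtonUnitEquationsNewtonTauWeak

namespace RefineDissociateAux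

/-- A binary tag `Σ_{j ∈ J} 2^j` of a subset `J ⊆ Fin N` is `< 2^N` (`Nat.geomSum_lt`). [folklore] -/
theorem sum_two_pow_lt {N : ℕ} (J : Finset (Fin N)) : ∑ j ∈ J, 2 ^ (j : ℕ) < 2 ^ N := by
  have h : ∑ j ∈ J, 2 ^ (j : ℕ) = ∑ i ∈ J.map Fin.valEmbedding, 2 ^ i := by simp
  rw [h]
  exact Nat.geomSum_lt le_rfl fun k hk => by
    obtain ⟨j, -, rfl⟩ := Finset.mem_map.1 hk
    exact j.isLt

/-- Binary representation: the tag `J ↦ Σ_{j ∈ J} 2^j` is injective on subsets of `Fin N`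
(`Finset.geomSum_injective` transported along `Fin.valEmbedding`). [folklore] -/
theorem sum_two_pow_injective (N : ℕ) :
    Function.Injective fun J : Finset (Fin N) => ∑ j ∈ J, 2 ^ (j : ℕ) := by
  intro J J' h
  have h' : ∑ i ∈ J.map Fin.valEmbedding, 2 ^ i = ∑ i ∈ J'.map Fin.valEmbedding, 2 ^ i := by
    simpa using h
  exact Finset.map_injective Fin.valEmbedding (Finset.geomSum_injective le_rfl h')

/-- Refined points `M • a J + (t J, 0)` with tags `t J < M` injective on `S` are injective on `S`: the first
coordinate modulo `M` recovers the tag. [folklore] -/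
theorem smul_add_single_injOn {ι : Type*} (S : Set ι) (a : ι → Fin 2 →₀ ℕ) (t : ι → ℕ) (M : ℕ)
    (htM : ∀ J ∈ S, t J < M) (ht : Set.InjOn t S) :
    Set.InjOn (fun J => M • a J + Finsupp.single 0 (t J)) S := by
  intro J hJ J' hJ' h
  have h0 : (M * a J 0 + t J) % M = (M * a J' 0 + t J') % M := by
    have h1 := congrArg (fun x : Fin 2 →₀ ℕ => x 0) h
    simp only [Finsupp.coe_add, Finsupp.coe_smul, Pi.add_apply, Pi.smul_apply, smul_eq_mul,
      Finsupp.single_eq_same] at h1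
    rw [h1]
  rw [Nat.mul_add_mod, Nat.mul_add_mod, Nat.mod_eq_of_lt (htM J hJ), Nat.mod_eq_of_lt (htM J' hJ')] at h0
  exact ht hJ hJ' h0

/-- The height `Σ_i w i · x i` of a refined point `M • x + (u, 0)` is `M · height x + w 0 · u`. [folklore] -/
theorem height_smul_add_single (w : Fin 2 → ℝ) (x : Fin 2 →₀ ℕ) (M u : ℕ) :
    ∑ i, w i * (((M • x + Finsupp.single 0 u : Fin 2 →₀ ℕ) i : ℕ) : ℝ) =
      (M : ℝ) * ∑ i, w i * ((x i : ℕ) : ℝ) + w 0 * (u : ℝ) := by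
  simp only [Fin.sum_univ_two, Finsupp.coe_add, Finsupp.coe_smul, Pi.add_apply, Pi.smul_apply,
    smul_eq_mul, Finsupp.single_eq_same, Finsupp.single_eq_of_ne (show (1 : Fin 2) ≠ 0 by decide)]
  push_cast
  ring

/-- A point `q` of a finite set `S ⊆ ℕ²` which is the strict maximiser over `S` of a linear height
`s ↦ Σ_i w i · s i` embeds to an extreme point of the convex hull of the embedded set
(`mem_extremePoints_convexHull_of_strict_sep` with the functional `w 0 • proj 0 + w 1 • proj 1`). [folklore] -/
theorem emb_mem_extremePoints_of_strict (S : Finset (Fin 2 →₀ ℕ)) {q : Fin 2 →₀ ℕ} (hq : q ∈ S)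
    (w : Fin 2 → ℝ)
    (h : ∀ s ∈ S, s ≠ q → ∑ i, w i * ((s i : ℕ) : ℝ) < ∑ i, w i * ((q i : ℕ) : ℝ)) :
    (fun i : Fin 2 => ((q i : ℕ) : ℝ)) ∈ Set.extremePoints ℝ (convexHull ℝ
      ((fun e : Fin 2 →₀ ℕ => fun i : Fin 2 => ((e i : ℕ) : ℝ)) '' (S : Set (Fin 2 →₀ ℕ)))) := by
  refine mem_extremePoints_convexHull_of_strict_sep ⟨q, hq, rfl⟩
    (w 0 • LinearMap.proj 0 + w 1 • LinearMap.proj 1 : (Fin 2 → ℝ) →ₗ[ℝ] ℝ) ?_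
  rintro y ⟨s, hs, rfl⟩ hne
  have hsq : s ≠ q := fun h' => hne (by rw [h'])
  simpa [Fin.sum_univ_two] using h s hs hsq

/-- **Monotonicity of the vertex count under refinement.**  For a finite family of points `a J ∈ ℕ²` (`J ∈ F`)
and tags `t J ≤ B` injective on `F`, for every sufficiently large scale `M` the convex hull of the refined
family `M • a J + (t J, 0)` has at least as many extreme points as that of the family `a J`: each old vertex
`emb p` (strictly exposed by a height `h_w` with `w 0 ≠ 0`, `stub_exposedGenericDirection`) yields the new
vertex `M • p + (t J_p, 0)`, `J_p` maximising `w 0 · t J` over the cluster `{J : a J = p}`, which is the strict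
maximiser of `h_w` over the refined family once `M (h_w p − h_w s) > 2 |w 0| B` for all old points `s ≠ p`;
distinct `p` give distinct new vertices (`smul_add_single_injOn`). [folklore] -/
theorem exists_scale_ncard_le {ι : Type*} (F : Finset ι) (a : ι → Fin 2 →₀ ℕ) (t : ι → ℕ) (B : ℕ)
    (htB : ∀ J ∈ F, t J ≤ B) (ht : Set.InjOn t F) :
    ∃ M₁ : ℕ, ∀ M : ℕ, M₁ ≤ M →
      (Set.extremePoints ℝ (convexHull ℝ ((fun e : Fin 2 →₀ ℕ => fun i : Fin 2 => ((e i : ℕ) : ℝ)) ''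
        (F.image a : Set (Fin 2 →₀ ℕ))))).ncard ≤
      (Set.extremePoints ℝ (convexHull ℝ ((fun e : Fin 2 →₀ ℕ => fun i : Fin 2 => ((e i : ℕ) : ℝ)) ''
        (F.image (fun J => M • a J + Finsupp.single 0 (t J)) : Set (Fin 2 →₀ ℕ))))).ncard := by
  classical
  -- degenerate case: no indices, no points, no vertices
  rcases isEmpty_or_nonempty ι with hι | hι
  · refine ⟨0, fun M _ => ?_⟩
    simp [Finset.eq_empty_of_isEmpty F]
  -- Step 0: the old vertex set is finite; exposing directions with non-zero first component
  have hPfin : (Set.extremePoints ℝ (convexHull ℝ ((fun e : Fin 2 →₀ ℕ => fun i : Fin 2 => ((e i : ℕ) : ℝ)) ''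
      (F.image a : Set (Fin 2 →₀ ℕ))))).Finite :=
    ((F.image a).finite_toSet.image _).subset extremePoints_convexHull_subset
  set P := hPfin.toFinset
  have hexp : ∀ e ∈ P, ∃ (w : Fin 2 → ℝ) (p : Fin 2 →₀ ℕ), p ∈ F.image a ∧
      (fun i : Fin 2 => ((p i : ℕ) : ℝ)) = e ∧
      (∀ s ∈ F.image a, s ≠ p → ∑ i, w i * ((s i : ℕ) : ℝ) < ∑ i, w i * ((p i : ℕ) : ℝ)) ∧ w 0 ≠ 0 := by
    intro e he
    obtain ⟨w, p, hpE, hpe, hlt, hinj⟩ :=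
      stub_exposedGenericDirection (F.image a) {0, Finsupp.single 0 1} e (hPfin.mem_toFinset.1 he)
    refine ⟨w, p, hpE, hpe, hlt, fun h0 => ?_⟩
    have h01 : (0 : Fin 2 →₀ ℕ) = Finsupp.single 0 1 :=
      hinj (by simp) (by simp) (by simp [Fin.sum_univ_two, h0])
    simpa using congrArg (fun x : Fin 2 →₀ ℕ => x 0) h01
  choose! w p hpE hpe hlt hw0 using hexp
  -- Step 1: a uniform scale, eventually along `atTop`
  have hev : ∀ᶠ M : ℕ in Filter.atTop, B < M ∧ ∀ e ∈ P, ∀ s ∈ F.image a, s ≠ p e →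
      2 * (|w e 0| * B) < (M : ℝ) * (∑ i, w e i * ((p e i : ℕ) : ℝ) - ∑ i, w e i * ((s i : ℕ) : ℝ)) := by
    refine (Filter.eventually_gt_atTop B).and ?_
    simp only [Filter.eventually_all_finset, Filter.eventually_imp_distrib_left]
    intro e he s hs hne
    exact (tendsto_natCast_atTop_atTop.atTop_mul_const (sub_pos.2 (hlt e he s hs hne))).eventually_gt_atTop _
  obtain ⟨M₁, hM₁⟩ := Filter.eventually_atTop.1 hev
  refine ⟨M₁, fun M hM => ?_⟩
  obtain ⟨hBM, hgood⟩ := hM₁ M hM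
  -- Step 2: the best index of each cluster
  have hbest : ∀ e ∈ P, ∃ Je ∈ F, a Je = p e ∧
      ∀ J ∈ F, a J = p e → w e 0 * (t J : ℝ) ≤ w e 0 * (t Je : ℝ) := by
    intro e he
    obtain ⟨J₀, hJ₀, hJ₀p⟩ := Finset.mem_image.1 (hpE e he)
    obtain ⟨Je, hJe, hmax⟩ := Finset.exists_max_image (F.filter fun J => a J = p e)
      (fun J => w e 0 * (t J : ℝ)) ⟨J₀, Finset.mem_filter.2 ⟨hJ₀, hJ₀p⟩⟩
    rw [Finset.mem_filter] at hJe
    exact ⟨Je, hJe.1, hJe.2, fun J hJ hJp => hmax J (Finset.mem_filter.2 ⟨hJ, hJp⟩)⟩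
  choose! Je hJeF hJea hJemax using hbest
  -- the perturbation `w 0 · t J` is uniformly bounded by `|w 0| B`
  have hb : ∀ e J, J ∈ F → |w e 0 * (t J : ℝ)| ≤ |w e 0| * B := fun e J hJ => by
    rw [abs_mul, Nat.abs_cast]
    exact mul_le_mul_of_nonneg_left (by exact_mod_cast htB J hJ) (abs_nonneg _)
  -- Step 3: the chosen refined point is the strict maximiser of the height over the refined family
  have hkey : ∀ e ∈ P, ∀ J ∈ F,
      M • a J + Finsupp.single 0 (t J) ≠ M • a (Je e) + Finsupp.single 0 (t (Je e)) →
      ∑ i, w e i * (((M • a J + Finsupp.single 0 (t J) : Fin 2 →₀ ℕ) i : ℕ) : ℝ) <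
        ∑ i, w e i * (((M • a (Je e) + Finsupp.single 0 (t (Je e)) : Fin 2 →₀ ℕ) i : ℕ) : ℝ) := by
    intro e he J hJ hne
    rw [height_smul_add_single, height_smul_add_single, hJea e he]
    by_cases hJp : a J = p e
    · rw [hJp]
      rcases (hJemax e he J hJ hJp).lt_or_eq with hlt' | heq
      · linarith
      · exfalso
        refine hne ?_
        have htt : (t J : ℝ) = t (Je e) := mul_left_cancel₀ (hw0 e he) heq
        rw [ht hJ (hJeF e he) (by exact_mod_cast htt)]
    · have h1 := hgood e he (a J) (Finset.mem_image_of_mem a hJ) hJp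
      obtain ⟨h3, -⟩ := abs_le.1 (hb e (Je e) (hJeF e he))
      obtain ⟨-, h4⟩ := abs_le.1 (hb e J hJ)
      linarith
  -- Step 4: the injection `e ↦ emb (M • p e + (t (Je e), 0))`
  have hinj : Function.Injective (fun e : Fin 2 →₀ ℕ => fun i : Fin 2 => ((e i : ℕ) : ℝ)) := by
    intro x y hxy
    ext i
    have hi := congr_fun hxy i
    dsimp only at hi
    exact_mod_cast hi
  refine Set.ncard_le_ncard_of_injOn
    (fun e => fun i : Fin 2 => (((M • a (Je e) + Finsupp.single 0 (t (Je e)) : Fin 2 →₀ ℕ) i : ℕ) : ℝ))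
    (fun e he => ?_) (fun e he e' he' hee => ?_)
    (((F.image _).finite_toSet.image _).subset extremePoints_convexHull_subset)
  · have heP : e ∈ P := hPfin.mem_toFinset.2 he
    refine emb_mem_extremePoints_of_strict _ (Finset.mem_image_of_mem _ (hJeF e heP)) (w e) ?_
    intro s hs hne
    obtain ⟨J, hJ, rfl⟩ := Finset.mem_image.1 hs
    exact hkey e heP J hJ hne
  · have heP : e ∈ P := hPfin.mem_toFinset.2 he
    have heP' : e' ∈ P := hPfin.mem_toFinset.2 he'
    have h2 : Je e = Je e' :=
      smul_add_single_injOn (F : Set ι) a t M (fun J hJ => (htB J hJ).trans_lt hBM) ht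
        (hJeF e heP) (hJeF e' heP') (hinj hee)
    have h3 : p e = p e' := by rw [← hJea e heP, ← hJea e' heP', h2]
    rw [← hpe e heP, ← hpe e' heP', h3]

end RefineDissociateAux

/-- **Stub S3 of line `binomial-normal-form`: dissociation is free for hull-vertex counts.**  For `N` items with
weights `g` and exponents `d ∈ ℕ²` (coinciding subset sums allowed) and a target weight `v` there is a
DISSOCIATED exponent list `d'` (all subset sums distinct) whose weight-`v` level set
`{Σ_J d' : Σ_J g = v}` has at least as many hull vertices as that of `d`.  Take `d' j = M • d j + (2^j, 0)` with
`M ≥ 2^N` large (`RefineDissociateAux.exists_scale_ncard_le`); the binary tags make `d'` dissociated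
(`RefineDissociateAux.smul_add_single_injOn`). [folklore] -/
theorem stub_refineDissociate (N v : ℕ) (g : Fin N → ℕ) (d : Fin N → (Fin 2 →₀ ℕ)) :
    ∃ d' : Fin N → (Fin 2 →₀ ℕ), (∀ J J' : Finset (Fin N), ∑ j ∈ J, d' j = ∑ j ∈ J', d' j → J = J') ∧
      (Set.extremePoints ℝ (convexHull ℝ ((fun e : Fin 2 →₀ ℕ => fun i : Fin 2 => ((e i : ℕ) : ℝ)) ''
        (((Finset.univ.filter fun J : Finset (Fin N) => ∑ j ∈ J, g j = v).image
          fun J => ∑ j ∈ J, d j : Finset (Fin 2 →₀ ℕ)) : Set (Fin 2 →₀ ℕ))))).ncard ≤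
      (Set.extremePoints ℝ (convexHull ℝ ((fun e : Fin 2 →₀ ℕ => fun i : Fin 2 => ((e i : ℕ) : ℝ)) ''
        (((Finset.univ.filter fun J : Finset (Fin N) => ∑ j ∈ J, g j = v).image
          fun J => ∑ j ∈ J, d' j : Finset (Fin 2 →₀ ℕ)) : Set (Fin 2 →₀ ℕ))))).ncard := by
  classical
  obtain ⟨M₁, hM₁⟩ := RefineDissociateAux.exists_scale_ncard_le
    (Finset.univ.filter fun J : Finset (Fin N) => ∑ j ∈ J, g j = v) (fun J => ∑ j ∈ J, d j)
    (fun J => ∑ j ∈ J, 2 ^ (j : ℕ)) (2 ^ N) (fun J _ => (RefineDissociateAux.sum_two_pow_lt J).le)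
    (RefineDissociateAux.sum_two_pow_injective N).injOn
  have hsum : ∀ J : Finset (Fin N), ∑ j ∈ J, ((M₁ + 2 ^ N) • d j + Finsupp.single 0 (2 ^ (j : ℕ))) =
      (M₁ + 2 ^ N) • ∑ j ∈ J, d j + Finsupp.single 0 (∑ j ∈ J, 2 ^ (j : ℕ)) := fun J => by
    rw [Finset.sum_add_distrib, Finset.smul_sum, Finsupp.single_finsetSum]
  refine ⟨fun j => (M₁ + 2 ^ N) • d j + Finsupp.single 0 (2 ^ (j : ℕ)), fun J J' h => ?_, ?_⟩
  · rw [hsum, hsum] at h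
    exact RefineDissociateAux.smul_add_single_injOn Set.univ (fun J => ∑ j ∈ J, d j)
      (fun J => ∑ j ∈ J, 2 ^ (j : ℕ)) (M₁ + 2 ^ N)
      (fun J _ => (RefineDissociateAux.sum_two_pow_lt J).trans_le le_add_self)
      (RefineDissociateAux.sum_two_pow_injective N).injOn (Set.mem_univ J) (Set.mem_univ J') h
  · simp only [hsum]
    exact hM₁ _ le_self_add

end Summit.ValiantsHypothesis.ValiantsHypothesis.Theorems.NewtonUnitEquationsNewtonTauWeak

end
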